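import Summits.CriticalPhenomena.Ising3DConformalLimit.Theses.TauBallRounding
import HarnessLib

/-!
# Crux `TauBallRounding.RoundnessTransfer` (stmt-CriticalPhenomena-4809) — birth skeleton, line `birth`

Registered by `planner-skel-stmt-CriticalPhenomena-4809-0` (skeleton-register one-shot, 2026-08-17) for route
`route-CriticalPhenomena-TauBallRounding` (sub-problem `Ising3DConformalLimit`).

## The crux

`RoundnessTransfer` : (P) some directional-rate function `τ` of the subcritical `+`-state two-point function
on `ℤ³` has a ROUND ENDPOINT (`τ β x / (τ β e₁ ‖x‖₂) → 1` as `β ↑ β_c(3)`, the conclusion of crux `RoundEndpoint`,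
item 4808) `→` (Q) for every `(ρ, Δ, S)` with (H1) `ρ > 0` on `(0,1]`, (H2) `HasPointwiseScalingLimit (criticalCorr 3) ρ S`,
(H3) `S = 0` off `NonCoincident`, (H4) `IsNondegenerateTwoPoint S`, (H5) `IsTranslationInvariant S`,
(H6) `IsScaleCovariant Δ S`: `IsRotationInvariant S` (all orders, all of `O(3)`).
Structure noted by the route-review refuter (c9f4b86e, 2026-08-15): `P → Q` with the `τ`-premise `P` not occurring
in `Q`; so any proof of `Q` outright is a proof of the crux.

## The line (= the route's own two-layer plan "RoundnessTransfer ⇐ [round τ → two-point isotropy of the limit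
(text of HyperoctahedralRP's TwoPointLimitIsotropic, item 1984)] → [two-point isotropy → IsRotationInvariant of
normalised limits]")

* STUB 1 `stub_roundShellToTwoPointIsotropy` (the bridge (B) at order `n = 2`): under (P), the two-point KERNEL
  `x ↦ S 2 ![0, x]` of every limit `S` satisfying (H1)–(H6) is invariant under every linear isometry of `ℝ³` off the
  origin.  Route mechanism: round `τ`-ball = `O(3)`-invariant one-particle shell; one-particle saturation of `⟨σσ⟩`
  down to `|x| ≍ ξ`; UV crossover `G_β ↑ G_{β_c}`.  STATUS IN TREE: dischargeable OUTRIGHT, ignoring (P) and (H3), by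
  the landed milestone `Summit.CriticalPhenomena.Ising3DConformalLimit.HyperoctahedralRPTwoPoint.twoPointLimitIsotropic_proof`
  (item stmt-1984 `HyperoctahedralRP.TwoPointLimitIsotropic`, closed/proved 2026-08-16,
  `Theorems/HyperoctahedralRPTwoPointLimitIsotropicHolds.lean`):
  `fun _ ρ Δ S hρ hlim _ hnd htr hsc => twoPointLimitIsotropic_proof ρ Δ S hρ hlim hnd htr hsc`.
* STUB 2 `stub_nPointUpgradeFromTwoPoint` (the `n ≥ 3` step): (H1)–(H6) + two-point kernel isotropy off `0` ⇒
  `IsRotationInvariant S`.  VERBATIM the signature of crux `GaussianScaleMixture.RotationUpgradeFromTwoPoint`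
  (item stmt-8367, closed/proved 2026-08-16T22:36Z by
  `Summit.CriticalPhenomena.Ising3DConformalLimit.Cruxes.RotationUpgradeFromTwoPoint.NullLaplacianEdgeGaussianity.RotationUpgradeFromTwoPoint_of`,
  `Theorems/GaussianScaleMixtureRotationUpgradeFromTwoPoint.lean`, exported there as `rotationUpgradeFromTwoPoint_proof`):
  `exact rotationUpgradeFromTwoPoint_proof`.
* COMPOSITION `RoundnessTransfer_of : RoundnessTransfer` — the registered skeleton theorem: concludes the route decl BY
  NAME with no hypotheses, its proof being the real composition of STUB 1 and STUB 2 (no `sorry` of its own; `sorryAx`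
  reaches it only through the stubs).  The same composition in arrow form `STUB-1-sig → STUB-2-sig → RoundnessTransfer`
  is kernel-checked below as a closing `example` (sorry-free).

Consequence for the lead: with items 1984 and 8367 landed, this crux should close in ONE cycle — import
`…Theorems.HyperoctahedralRPTwoPointLimitIsotropicHolds` and `…Theorems.GaussianScaleMixtureRotationUpgradeFromTwoPoint`,
discharge both stubs by the two displayed terms, and `RoundnessTransfer_of` is the route decl (the `τ`-premise (P) is
then honestly idle, exactly as the refuter's structural caveat predicted; the route's independent content stays in
T1/T2 = items 4807/4808).  The registrar does not prove; this file deliberately imports neither Theorems module so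
that the stubs stay honest `sorry`s and the BC3 probes run in the bare route context.

## Disproof used

No `Disproof.lean` exists for this crux (`ledger crux ls stmt-CriticalPhenomena-4809`: no workfiles at registration)
and no `Theorems/RoundnessTransfer/Negative/` lemma is landed.  Nearest negative knowledge, honoured: (i) the
coincident-locus junk of `Theorems/IsingEuclidUpgradeRefutations.lean` — both stubs carry the normalisation hypothesis
(H3) of the crux verbatim; (ii) `Theorems/RotationUpgradeFromTwoPoint/Negative/AutomaticOrders.lean` (sibling crux
8367: orders `0`, odd, `2` are automatic given two-point kernel isotropy; (H5), (H6) redundant given (H1)–(H4)) —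
consistent with the cut: STUB 1 is exactly the order-2 input, STUB 2 the even orders `≥ 4`; (iii) the refuter's
route-review note on 4809: the model-blind version (round mass shell, anisotropic UV profile) is false, so a proof
must use the Ising scaling-limit hypothesis (H2) — load-bearing in both stubs.
-/

namespace Summit.CriticalPhenomena.Ising3DConformalLimit.Cruxes.RoundnessTransfer.Birth

open scoped BigOperators

/-- STUB 1 (the bridge at order `n = 2`).  If some directional rate `τ` of the subcritical two-point function has a
round endpoint (hypothesis (P) of the crux, verbatim), then the two-point kernel `x ↦ S 2 ![0, x]` of every
normalised, non-degenerate, translation-invariant, scale-covariant pointwise scaling limit `S` of `criticalCorr 3`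
is invariant under all linear isometries off the origin.  Why plausibly true: it is implied (even without (P)) by the
landed item 1984 `HyperoctahedralRP.TwoPointLimitIsotropic` (nine-mirror RP of the limit kernel + `HRP2Rigidity`);
the route's own mechanism (one-particle shell + UV crossover) is the `τ`-side reading.  Size: XL by the route's
mechanism, XS by citation. -/
theorem stub_roundShellToTwoPointIsotropy :
    (∃ τ : ℝ → Literature.Probability.LatticeModels.Site 3 → ℝ,
      (∀ (β : ℝ) (x : Literature.Probability.LatticeModels.Site 3), 0 < β →
        β < Literature.Probability.LatticeModels.criticalBeta 3 →
        Filter.Tendsto (fun n : ℕ => -Real.log (Literature.Probability.LatticeModels.twoPointPlus 3 β ((n : ℤ) • x)) / (n : ℝ))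
          Filter.atTop (nhds (τ β x))) ∧
      ∀ x : Literature.Probability.LatticeModels.Site 3, x ≠ 0 →
        Filter.Tendsto (fun β : ℝ => τ β x / (τ β (Pi.single 0 1) * Real.sqrt (∑ i, ((x i : ℝ)) ^ 2)))
          (nhdsWithin (Literature.Probability.LatticeModels.criticalBeta 3)
            (Set.Iio (Literature.Probability.LatticeModels.criticalBeta 3))) (nhds 1)) →
    ∀ (ρ : ℝ → ℝ) (Δ : ℝ) (S : Literature.Probability.LatticeModels.CorrFamily 3),
      (∀ δ ∈ Set.Ioc (0:ℝ) 1, 0 < ρ δ) →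
      Literature.Probability.LatticeModels.HasPointwiseScalingLimit
        (Literature.Probability.LatticeModels.criticalCorr 3) ρ S →
      (∀ n z, z ∉ Literature.Probability.LatticeModels.NonCoincident 3 n → S n z = 0) →
      Literature.Probability.LatticeModels.IsNondegenerateTwoPoint S →
      Literature.Probability.LatticeModels.IsTranslationInvariant S →
      Literature.Probability.LatticeModels.IsScaleCovariant Δ S →
      ∀ (R : EuclideanSpace ℝ (Fin 3) ≃ₗᵢ[ℝ] EuclideanSpace ℝ (Fin 3)) (x : EuclideanSpace ℝ (Fin 3)),
        x ≠ 0 → S 2 ![0, R x] = S 2 ![0, x] := by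
  sorry

/-- STUB 2 (`n ≥ 3`, the n-point upgrade).  Every normalised, non-degenerate, translation-invariant, scale-covariant
pointwise scaling limit `S` of `criticalCorr 3` whose two-point kernel is isometry-invariant off `0` is `IsRotationInvariant`
(all orders, `O(3)` incl. reflections).  Verbatim the signature of crux `GaussianScaleMixture.RotationUpgradeFromTwoPoint`
(item stmt-8367, closed/proved): discharge by
`Cruxes.RotationUpgradeFromTwoPoint.NullLaplacianEdgeGaussianity.rotationUpgradeFromTwoPoint_proof`.  Why plausibly true:
it is a theorem of the tree (nine-mirror OS positivity of the Ising limit + unit sigma bound + quarter-turn Liouville;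
Gaussian locus by Wick, edge `Δ = 1/2` by Bôcher–Liouville).  Size: XL as mathematics (citation: XS). -/
theorem stub_nPointUpgradeFromTwoPoint :
    ∀ (ρ : ℝ → ℝ) (Δ : ℝ) (S : Literature.Probability.LatticeModels.CorrFamily 3),
      (∀ δ ∈ Set.Ioc (0:ℝ) 1, 0 < ρ δ) →
      Literature.Probability.LatticeModels.HasPointwiseScalingLimit
        (Literature.Probability.LatticeModels.criticalCorr 3) ρ S →
      (∀ n z, z ∉ Literature.Probability.LatticeModels.NonCoincident 3 n → S n z = 0) →
      Literature.Probability.LatticeModels.IsNondegenerateTwoPoint S →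
      Literature.Probability.LatticeModels.IsTranslationInvariant S →
      Literature.Probability.LatticeModels.IsScaleCovariant Δ S →
      (∀ (R : EuclideanSpace ℝ (Fin 3) ≃ₗᵢ[ℝ] EuclideanSpace ℝ (Fin 3)) (x : EuclideanSpace ℝ (Fin 3)),
        x ≠ 0 → S 2 ![0, R x] = S 2 ![0, x]) →
      Literature.Probability.LatticeModels.IsRotationInvariant S := by
  sorry

/-- REGISTERED COMPOSITION (the skeleton theorem): concludes the route decl `RoundnessTransfer` BY NAME, with NO
hypotheses; its proof is the real composition of the two declared stubs (no `sorry` of its own — `sorryAx` enters only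
through `stub_*`, so the day both stubs are theorems this declaration IS the crux proof).  Given (P) and a limit
`(ρ, Δ, S)` with (H1)–(H6), STUB 1 supplies two-point kernel isotropy, STUB 2 upgrades it to all orders. -/
theorem RoundnessTransfer_of :
    Summit.CriticalPhenomena.Ising3DConformalLimit.Theses.TauBallRounding.RoundnessTransfer := by
  -- `RoundnessTransfer` is the route `def`; expose its binders
  unfold Summit.CriticalPhenomena.Ising3DConformalLimit.Theses.TauBallRounding.RoundnessTransfer
  intro hP ρ Δ S hρ hlim hnorm hnd htr hsc
  exact stub_nPointUpgradeFromTwoPoint ρ Δ S hρ hlim hnorm hnd htr hsc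
    (stub_roundShellToTwoPointIsotropy hP ρ Δ S hρ hlim hnorm hnd htr hsc)

/- COMPOSITION IN ARROW FORM (BC3 shape `stub₁-sig → stub₂-sig → C`, kernel-checked, sorry-free): stated as an
`example` so that exactly ONE constant of this file concludes the crux by name (the registered `RoundnessTransfer_of`). -/
example :
    ((∃ τ : ℝ → Literature.Probability.LatticeModels.Site 3 → ℝ,
      (∀ (β : ℝ) (x : Literature.Probability.LatticeModels.Site 3), 0 < β →
        β < Literature.Probability.LatticeModels.criticalBeta 3 →
        Filter.Tendsto (fun n : ℕ => -Real.log (Literature.Probability.LatticeModels.twoPointPlus 3 β ((n : ℤ) • x)) / (n : ℝ))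
          Filter.atTop (nhds (τ β x))) ∧
      ∀ x : Literature.Probability.LatticeModels.Site 3, x ≠ 0 →
        Filter.Tendsto (fun β : ℝ => τ β x / (τ β (Pi.single 0 1) * Real.sqrt (∑ i, ((x i : ℝ)) ^ 2)))
          (nhdsWithin (Literature.Probability.LatticeModels.criticalBeta 3)
            (Set.Iio (Literature.Probability.LatticeModels.criticalBeta 3))) (nhds 1)) →
    ∀ (ρ : ℝ → ℝ) (Δ : ℝ) (S : Literature.Probability.LatticeModels.CorrFamily 3),
      (∀ δ ∈ Set.Ioc (0:ℝ) 1, 0 < ρ δ) →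
      Literature.Probability.LatticeModels.HasPointwiseScalingLimit
        (Literature.Probability.LatticeModels.criticalCorr 3) ρ S →
      (∀ n z, z ∉ Literature.Probability.LatticeModels.NonCoincident 3 n → S n z = 0) →
      Literature.Probability.LatticeModels.IsNondegenerateTwoPoint S →
      Literature.Probability.LatticeModels.IsTranslationInvariant S →
      Literature.Probability.LatticeModels.IsScaleCovariant Δ S →
      ∀ (R : EuclideanSpace ℝ (Fin 3) ≃ₗᵢ[ℝ] EuclideanSpace ℝ (Fin 3)) (x : EuclideanSpace ℝ (Fin 3)),
        x ≠ 0 → S 2 ![0, R x] = S 2 ![0, x]) →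
    (∀ (ρ : ℝ → ℝ) (Δ : ℝ) (S : Literature.Probability.LatticeModels.CorrFamily 3),
      (∀ δ ∈ Set.Ioc (0:ℝ) 1, 0 < ρ δ) →
      Literature.Probability.LatticeModels.HasPointwiseScalingLimit
        (Literature.Probability.LatticeModels.criticalCorr 3) ρ S →
      (∀ n z, z ∉ Literature.Probability.LatticeModels.NonCoincident 3 n → S n z = 0) →
      Literature.Probability.LatticeModels.IsNondegenerateTwoPoint S →
      Literature.Probability.LatticeModels.IsTranslationInvariant S →
      Literature.Probability.LatticeModels.IsScaleCovariant Δ S →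
      (∀ (R : EuclideanSpace ℝ (Fin 3) ≃ₗᵢ[ℝ] EuclideanSpace ℝ (Fin 3)) (x : EuclideanSpace ℝ (Fin 3)),
        x ≠ 0 → S 2 ![0, R x] = S 2 ![0, x]) →
      Literature.Probability.LatticeModels.IsRotationInvariant S) →
    Summit.CriticalPhenomena.Ising3DConformalLimit.Theses.TauBallRounding.RoundnessTransfer := by
  intro h1 h2
  -- `RoundnessTransfer` is the route `def`; expose its binders
  unfold Summit.CriticalPhenomena.Ising3DConformalLimit.Theses.TauBallRounding.RoundnessTransfer
  intro hP ρ Δ S hρ hlim hnorm hnd htr hsc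
  exact h2 ρ Δ S hρ hlim hnorm hnd htr hsc (h1 hP ρ Δ S hρ hlim hnorm hnd htr hsc)

end Summit.CriticalPhenomena.Ising3DConformalLimit.Cruxes.RoundnessTransfer.Birth
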